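import Summits.ResolutionOfSingularities.ResolutionOfSingularities.Theorems.WeightedInvariantPartialChart
import Summits.ResolutionOfSingularities.ResolutionOfSingularities.Theorems.WeightedInvariantHypersurfaceLocalGameEFTDimTwoNewton
import HarnessLib

/-!
# The P3a cylinder move, type (b) successors: the special-fibre chart and the face form `Φ` (ORDER (o36))

Topic: `Summits/ResolutionOfSingularities/ResolutionOfSingularities/Theorems`. Helper for the door item
`HypersurfaceCentreConstruction` (statement `stmt-ResolutionOfSingularities-19897`, route `WeightedInvariant`), line
`local-engine` of `res-L1-w43-plan-1`, IOTA3-DESIGN v1.3 §8.4 regime CURVE° «ν drops strictly at every successor»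
(RULING gen 11 #2, 2026-08-27T12:09:48Z), ORDER (o36) held by res-type-092 (design memo
`plan/tools/res-type-092/o36/O36-DESIGN.md` c9cc04d440dbcb6e §2/§6, type (b) = successors OVER THE SPECIAL POINT).

SETTING. `S` regular local with regular system of parameters `(y, x, z)` (`span = 𝔪`, `spanFinrank 𝔪 = 3`),
`P = (y, x)` prime, weights `(r, q)` on `(y, x)` (positive), `B = S[t⁻¹, 𝒥ₙ tⁿ]`, `𝒥ₙ = 𝒥ₙ((y, x); (r, q))` — the
cobordant algebra of the CYLINDER `V(P)` with the transversal weights (the variable `z` has weight `0` and lives in the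
coefficient ring `A = S ⧸ P`, a discrete valuation ring).  CONTENTS (def-free; every map is delivered by `∃`; THIS FILE
is §1–§2, the sibling `…P3aSpecialFibreFace` is §3–§5, split for the 400-line rule):

* §1 `linearIndependent_toCotangent_pair` — `(y, x)` is a cotangent-independent sub-family (input of res-type-092's
  `LocalGameEFTPointMove.exists_rhoPartial`, p531646: the chart `ρ : B ↠ A[X₀, X₁]`, `ker ρ = (t⁻¹)`).
* §2 **`exists_rhoZero`** — the SPECIAL-FIBRE CHART `ρ₀ : B ↠ κ[X₀, X₁]` (`κ = S ⧸ 𝔪`), `ρ₀ = (A → κ) ∘ ρ`: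
  `ρ₀(y t^r) = X₀`, `ρ₀(x t^q) = X₁`, `ρ₀(a) = ā`, **`ker ρ₀ = (t⁻¹, z)`** (`𝔪 = P + (z)`); a prime `𝔫 ∋ t⁻¹, z` of `B`
  (a successor over the special point) is `ρ₀⁻¹(𝔫̄₀)`, `𝔫̄₀ = ρ₀(𝔫)` prime, off the vertex `⇒ (X₀, X₁) ⊄ 𝔫̄₀`.
* §3 `exists_finsupp_of_mem_weightedMonomialIdeal` (a member of `𝒥ₙ(u; w)` is a finite `S`-combination of monomials
  of weight `≥ n`) and **`exists_transform_of_finsupp`**: `f = (t⁻¹)ⁿ · G` with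
  `ρ₀(G) = Φ := Σ_{w·α = n} ā_α X^α` — the `(r, q)`-FACE FORM OF THE SPECIAL FIBRE `f₀ = f(y, x, 0)`.
* §4 `face_ne_zero`: for `n = rν`, `q ≤ r` and `f ∉ 𝔪^{ν+1}`, `Φ ≠ 0` (faces of `𝒥_{rν}` have total degree `≥ ν`,
  `𝒥_{rν+1} ⊆ 𝔪^{ν+1}`); hence `t⁻¹ ∤ G` and (`B` a domain, `(t⁻¹)` prime) EVERY saturated factorisation
  `f = (t⁻¹)ᵃ g`, `t⁻¹ ∤ g`, has `g = G` (`transform_unique₀`).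
* §5 TRANSFER `not_mem_pow_of_rhoZero`: `Φ/1 ∉ 𝔪_{𝔫̄₀}^ν ⇒ g/1 ∉ 𝔪_𝔫^ν`; `Φ ∉ 𝔫̄₀ ⇒ g/1` a unit.

The sequel `…P3aTieFreeDrop` feeds `Φ` to res-type-098's face bound `LexMaxOrderDrop.algebraMap_lexFace_notMem_pow`
(non-degenerate faces) and treats the tie curve.  [OURS · L1 W4.3] Replaces the role of NO printed item; NOT a statement
of the manuscript under review [claim: Hironaka2017, status: under-review].  AI work, weaker than expert review.

## References

* J. Włodarczyk, *Functorial resolution by torus actions*, arXiv:2203.03090, §2.3.9, §3.3, Lemma 4.1.7. [Wlodarczyk2022]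
* D. Abramovich, M. H. Quek, B. Schober, arXiv:2507.01232 (v3, 2026), Thm 1.3 (3), §5. [AbramovichQuekSchober2025]
-/

noncomputable section

open IsLocalRing Literature.AlgebraicGeometry.Resolution
open LaurentPolynomial
open scoped LaurentPolynomial

set_option linter.dupNamespace false -- mandated namespace of this single-conjunct summit

namespace Summit.ResolutionOfSingularities.ResolutionOfSingularities.Theorems

namespace LocalGameEFTCylinder

universe u

/-- `range (X : Fin 2 → R[X₀, X₁]) = {X₀, X₁}`. [folklore] -/
theorem range_X_two (κ : Type*) [CommSemiring κ] :
    Set.range (MvPolynomial.X : Fin 2 → MvPolynomial (Fin 2) κ) = {MvPolynomial.X 0, MvPolynomial.X 1} := by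
  ext p
  simp only [Set.mem_range, Fin.exists_fin_two, Set.mem_insert_iff, Set.mem_singleton_iff, eq_comm]

variable {S : Type} [CommRing S]

/-! ### §1 The sub-family `(y, x)` of the regular system of parameters `(y, x, z)` -/

/-- The members of a generating triple of `𝔪` lie in `𝔪`. [folklore] -/
theorem mem_maximalIdeal_of_span_three [IsLocalRing S] {y x z : S}
    (hyxz : Ideal.span (Set.range ![y, x, z]) = maximalIdeal S) (i : Fin 3) : ![y, x, z] i ∈ maximalIdeal S :=
  hyxz ▸ Ideal.subset_span ⟨i, rfl⟩

/-- `(y, x) ⊆ 𝔪`. [folklore] -/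
theorem span_pair_le_maximalIdeal [IsLocalRing S] {y x z : S}
    (hyxz : Ideal.span (Set.range ![y, x, z]) = maximalIdeal S) : Ideal.span (Set.range ![y, x]) ≤ maximalIdeal S := by
  rw [Ideal.span_le]
  rintro _ ⟨i, rfl⟩
  fin_cases i
  · exact mem_maximalIdeal_of_span_three hyxz 0
  · exact mem_maximalIdeal_of_span_three hyxz 1

/-- The members of `(y, x)` lie in `𝔪`. [folklore] -/
theorem mem_maximalIdeal_pair [IsLocalRing S] {y x z : S}
    (hyxz : Ideal.span (Set.range ![y, x, z]) = maximalIdeal S) (i : Fin 2) : ![y, x] i ∈ maximalIdeal S :=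
  span_pair_le_maximalIdeal hyxz (Ideal.subset_span ⟨i, rfl⟩)

/-- **`(y, x)` is part of a regular system of parameters**: its cotangent classes are linearly independent.
[cite: Matsumura1987, Thm. 14.2] -/
theorem linearIndependent_toCotangent_pair [IsRegularLocalRing S] {y x z : S}
    (hyxz : Ideal.span (Set.range ![y, x, z]) = maximalIdeal S) (hd : (maximalIdeal S).spanFinrank = 3) :
    LinearIndependent (ResidueField S) fun i : Fin 2 =>
      (maximalIdeal S).toCotangent ⟨![y, x] i, mem_maximalIdeal_pair hyxz i⟩ := by
  have hdim : ringKrullDim S = (3 : ℕ) := by rw [← IsRegularLocalRing.spanFinrank_maximalIdeal, hd]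
  have h3 := linearIndependent_toCotangent_of_span_eq_maximalIdeal hdim ![y, x, z] hyxz
  have hι : Function.Injective (Fin.castSucc : Fin 2 → Fin 3) := Fin.castSucc_injective 2
  have h2 := h3.comp _ hι
  convert h2 using 1
  funext i
  fin_cases i <;> rfl

/-! ### §2 The special-fibre chart `ρ₀ : B ↠ κ[X₀, X₁]` -/

section Chart

variable [IsRegularLocalRing S] {y x z : S} (hyxz : Ideal.span (Set.range ![y, x, z]) = maximalIdeal S)
  (hd : (maximalIdeal S).spanFinrank = 3) (w : Fin 2 → ℕ) (hw : ∀ i, 0 < w i)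

/-- `z ∉ (y, x)` (else `𝔪` would be generated by two elements). [folklore] -/
theorem notMem_span_pair (hyxz : Ideal.span (Set.range ![y, x, z]) = maximalIdeal S)
    (hd : (maximalIdeal S).spanFinrank = 3) : z ∉ Ideal.span (Set.range ![y, x]) := by
  intro hz
  have hle : maximalIdeal S ≤ Ideal.span (Set.range ![y, x]) := by
    rw [← hyxz, Ideal.span_le]
    rintro _ ⟨i, rfl⟩
    fin_cases i
    · exact Ideal.subset_span ⟨0, rfl⟩
    · exact Ideal.subset_span ⟨1, rfl⟩
    · exact hz
  have heq : Ideal.span (Set.range ![y, x]) = maximalIdeal S := le_antisymm (span_pair_le_maximalIdeal hyxz) hle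
  have h2 : (maximalIdeal S).spanFinrank ≤ 2 := by
    rw [← heq, Matrix.range_cons_cons_empty]
    calc (Ideal.span ({y, x} : Set S)).spanFinrank ≤ ({y, x} : Set S).ncard :=
          Submodule.spanFinrank_span_le_ncard_of_finite (Set.toFinite _)
      _ ≤ ({x} : Set S).ncard + 1 := Set.ncard_insert_le y {x}
      _ = 2 := by rw [Set.ncard_singleton]
  omega

include hyxz in
/-- The kernel of `A = S ⧸ (y, x) → κ`: an element of `𝔪` is `≡ c·z (mod (y, x))`. [folklore] -/
theorem exists_eq_add_mul_of_mem_maximalIdeal {a : S} (ha : a ∈ maximalIdeal S) :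
    ∃ b ∈ Ideal.span (Set.range ![y, x]), ∃ c : S, a = b + c * z := by
  rw [← hyxz, Matrix.range_cons, Matrix.range_cons_cons_empty, Set.singleton_union, Ideal.mem_span_insert] at ha
  obtain ⟨cy, a', ha', rfl⟩ := ha
  rw [Ideal.mem_span_insert] at ha'
  obtain ⟨cx, a'', ha'', rfl⟩ := ha'
  obtain ⟨cz, rfl⟩ := Ideal.mem_span_singleton'.mp ha''
  refine ⟨cy * y + cx * x, ?_, cz, by ring⟩
  rw [Matrix.range_cons_cons_empty]
  exact Ideal.add_mem _ (Ideal.mul_mem_left _ _ (Ideal.subset_span (by simp)))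
    (Ideal.mul_mem_left _ _ (Ideal.subset_span (by simp)))

include hyxz hd hw in
/-- **The special-fibre chart.**  There is a surjective ring map `ρ₀ : B = S[t⁻¹, 𝒥ₙ((y,x); w) tⁿ] ↠ κ[X₀, X₁]`
(`κ = S ⧸ 𝔪`) with `ρ₀(y t^{w₀}) = X₀`, `ρ₀(x t^{w₁}) = X₁`, `ρ₀(a) = ā` for `a ∈ S`, and KERNEL `(t⁻¹, z)`: the reduction
modulo `z̄` of the exceptional chart `B/(t⁻¹) ≅ (S ⧸ (y, x))[X₀, X₁]`. [cite: Wlodarczyk2022, §2.3.9] -/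
theorem exists_rhoZero :
    ∃ ρ₀ : extReesAlgebra (weightedMonomialIdeal ![y, x] w) →+* MvPolynomial (Fin 2) (ResidueField S),
      Function.Surjective ρ₀ ∧
      RingHom.ker ρ₀ = Ideal.span {extReesAlgebra.tInv (weightedMonomialIdeal ![y, x] w),
        algebraMap S (extReesAlgebra (weightedMonomialIdeal ![y, x] w)) z} ∧
      (∀ i, ρ₀ (LocalGameEFTPointMove.uT ![y, x] w i) = MvPolynomial.X i) ∧
      (∀ a : S, ρ₀ (algebraMap S _ a) = MvPolynomial.C (residue S a)) ∧
      ρ₀ (extReesAlgebra.tInv (weightedMonomialIdeal ![y, x] w)) = 0 := by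
  obtain ⟨ρ, hρs, hker, hX, hC, hT⟩ := LocalGameEFTPointMove.exists_rhoPartial ![y, x] w hw
    (mem_maximalIdeal_pair hyxz) (linearIndependent_toCotangent_pair hyxz hd)
  -- the reduction `A = S ⧸ (y, x) → κ`
  have hIle : ∀ a ∈ Ideal.span (Set.range ![y, x]), residue S a = 0 := fun a ha =>
    (residue_eq_zero_iff _).mpr (span_pair_le_maximalIdeal hyxz ha)
  obtain ⟨π, hπmk⟩ : ∃ π : S ⧸ Ideal.span (Set.range ![y, x]) →+* ResidueField S,
      ∀ a : S, π (Ideal.Quotient.mk _ a) = residue S a :=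
    ⟨Ideal.Quotient.lift _ (residue S) hIle, fun a => Ideal.Quotient.lift_mk _ _ _⟩
  have hπs : Function.Surjective π := by
    intro c
    obtain ⟨a, rfl⟩ := residue_surjective c
    exact ⟨Ideal.Quotient.mk _ a, hπmk a⟩
  -- its kernel is `(z̄)`
  have hkerπ : ∀ b : S ⧸ Ideal.span (Set.range ![y, x]), π b = 0 →
      ∃ c : S ⧸ Ideal.span (Set.range ![y, x]), b = c * Ideal.Quotient.mk _ z := by
    intro b hb
    obtain ⟨a, rfl⟩ := Ideal.Quotient.mk_surjective b
    rw [hπmk, residue_eq_zero_iff] at hb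
    obtain ⟨b', hb', c, rfl⟩ := exists_eq_add_mul_of_mem_maximalIdeal hyxz hb
    refine ⟨Ideal.Quotient.mk _ c, ?_⟩
    rw [map_add, Ideal.Quotient.eq_zero_iff_mem.mpr hb', zero_add, map_mul]
  refine ⟨(MvPolynomial.map π).comp ρ, ?_, ?_, fun i => ?_, fun a => ?_, ?_⟩
  · exact (MvPolynomial.map_surjective π hπs).comp hρs
  · apply le_antisymm
    · intro b hb
      rw [RingHom.mem_ker, RingHom.comp_apply] at hb
      have hb' : ρ b ∈ RingHom.ker (MvPolynomial.map π :
          MvPolynomial (Fin 2) (S ⧸ Ideal.span (Set.range ![y, x])) →+* MvPolynomial (Fin 2) (ResidueField S)) :=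
        hb
      rw [MvPolynomial.ker_map] at hb'
      -- `ρ b ∈ (ker π)·A[X] ⊆ (z̄)·A[X] = (ρ z)`
      have hsub : Ideal.map (MvPolynomial.C : S ⧸ Ideal.span (Set.range ![y, x]) →+*
          MvPolynomial (Fin 2) (S ⧸ Ideal.span (Set.range ![y, x]))) (RingHom.ker π) ≤ Ideal.span {ρ (algebraMap S _ z)} := by
        rw [Ideal.map_le_iff_le_comap]
        intro c hc
        obtain ⟨c', rfl⟩ := hkerπ c hc
        rw [Ideal.mem_comap, map_mul, hC z]
        exact Ideal.mul_mem_left _ _ (Ideal.mem_span_singleton_self _)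
      obtain ⟨h, hh⟩ := Ideal.mem_span_singleton'.mp (hsub hb')
      obtain ⟨b', rfl⟩ := hρs h
      have hdiff : b - b' * algebraMap S _ z ∈ RingHom.ker ρ := by
        rw [RingHom.mem_ker, map_sub, map_mul, hh, sub_self]
      rw [hker] at hdiff
      obtain ⟨c, hc⟩ := Ideal.mem_span_singleton'.mp hdiff
      have hb_eq : b = c * extReesAlgebra.tInv (weightedMonomialIdeal ![y, x] w) + b' * algebraMap S _ z := by
        rw [hc]; ring
      rw [hb_eq]
      exact Ideal.add_mem _ (Ideal.mul_mem_left _ _ (Ideal.subset_span (Set.mem_insert _ _)))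
        (Ideal.mul_mem_left _ _ (Ideal.subset_span (Set.mem_insert_of_mem _ (Set.mem_singleton _))))
    · rw [Ideal.span_le, Set.insert_subset_iff, Set.singleton_subset_iff, SetLike.mem_coe, SetLike.mem_coe,
        RingHom.mem_ker, RingHom.mem_ker, RingHom.comp_apply, RingHom.comp_apply, hT, map_zero, hC,
        MvPolynomial.map_C, hπmk]
      have hz : residue S z = 0 := (residue_eq_zero_iff _).mpr (mem_maximalIdeal_of_span_three hyxz 2)
      rw [hz, MvPolynomial.C_0]
      exact ⟨rfl, rfl⟩
  · rw [RingHom.comp_apply, hX, MvPolynomial.map_X]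
  · rw [RingHom.comp_apply, hC, MvPolynomial.map_C, hπmk]
  · rw [RingHom.comp_apply, hT, map_zero]

end Chart

/-! ### §2b Primes over the special point, read through `ρ₀` -/

section Primes

variable {B P : Type} [CommRing B] [CommRing P] (ρ₀ : B →+* P) (hρ : Function.Surjective ρ₀)

include hρ in
/-- `ρ₀⁻¹(ρ₀ 𝔫) = 𝔫` for `𝔫 ⊇ ker ρ₀`. [folklore] -/
theorem comap_map_eq_of_ker_le (𝔫 : Ideal B) (hker : RingHom.ker ρ₀ ≤ 𝔫) : (𝔫.map ρ₀).comap ρ₀ = 𝔫 := by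
  rw [Ideal.comap_map_of_surjective' _ hρ]
  exact sup_eq_left.mpr hker

include hρ in
/-- `ρ₀ 𝔫` is prime for a prime `𝔫 ⊇ ker ρ₀`. [folklore] -/
theorem map_isPrime_of_ker_le (𝔫 : Ideal B) [𝔫.IsPrime] (hker : RingHom.ker ρ₀ ≤ 𝔫) : (𝔫.map ρ₀).IsPrime :=
  Ideal.map_isPrime_of_surjective hρ hker

/-- A two-generated kernel lies in `𝔫` as soon as its generators do. [folklore] -/
theorem ker_le_of_eq_span_pair {t s : B} (hker : RingHom.ker ρ₀ = Ideal.span {t, s}) (𝔫 : Ideal B) (ht : t ∈ 𝔫)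
    (hs : s ∈ 𝔫) : RingHom.ker ρ₀ ≤ 𝔫 := by
  rw [hker, Ideal.span_le, Set.insert_subset_iff, Set.singleton_subset_iff]
  exact ⟨ht, hs⟩

end Primes

/-- **Off the vertex, `ρ₀(𝔫)` misses a variable.** [cite: Wlodarczyk2022, Def. 2.3.5] -/
theorem not_span_X_le_map {d : ℕ} {u : Fin d → S} {w : Fin d → ℕ} {κ : Type} [CommRing κ]
    {ρ₀ : extReesAlgebra (weightedMonomialIdeal u w) →+* MvPolynomial (Fin d) κ} (hρ : Function.Surjective ρ₀)
    (hX : ∀ i, ρ₀ (LocalGameEFTPointMove.uT u w i) = MvPolynomial.X i)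
    (𝔫 : Ideal (extReesAlgebra (weightedMonomialIdeal u w))) (hker : RingHom.ker ρ₀ ≤ 𝔫)
    (hV : ¬ extReesAlgebra.vertexIdeal (weightedMonomialIdeal u w) ≤ 𝔫) :
    ¬ Ideal.span (Set.range (MvPolynomial.X : Fin d → MvPolynomial (Fin d) κ)) ≤ 𝔫.map ρ₀ := by
  intro hle
  obtain ⟨i, hi⟩ := LocalGameEFTPointMove.exists_uT_not_mem u w hV
  apply hi
  rw [← comap_map_eq_of_ker_le ρ₀ hρ 𝔫 hker, Ideal.mem_comap, hX]
  exact hle (Ideal.subset_span ⟨i, rfl⟩)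

/-- Two-variable form: `(X₀, X₁) ⊄ ρ₀(𝔫)`. [folklore] -/
theorem not_span_pair_X_le_map {u : Fin 2 → S} {w : Fin 2 → ℕ} {κ : Type} [CommRing κ]
    {ρ₀ : extReesAlgebra (weightedMonomialIdeal u w) →+* MvPolynomial (Fin 2) κ} (hρ : Function.Surjective ρ₀)
    (hX : ∀ i, ρ₀ (LocalGameEFTPointMove.uT u w i) = MvPolynomial.X i)
    (𝔫 : Ideal (extReesAlgebra (weightedMonomialIdeal u w))) (hker : RingHom.ker ρ₀ ≤ 𝔫)
    (hV : ¬ extReesAlgebra.vertexIdeal (weightedMonomialIdeal u w) ≤ 𝔫) :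
    ¬ Ideal.span {(MvPolynomial.X 0 : MvPolynomial (Fin 2) κ), MvPolynomial.X 1} ≤ 𝔫.map ρ₀ := by
  have h := not_span_X_le_map hρ hX 𝔫 hker hV
  rwa [range_X_two] at h

end LocalGameEFTCylinder

end Summit.ResolutionOfSingularities.ResolutionOfSingularities.Theorems

end
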